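import Summits.Ventures.PercRepro.Night2ShapeOneSigma

/-!
# PercRepro — the seven-point shape (i): PER-SIDE bounds of the column bound, part A (night-2, gen 30)

ONE SIDE = one line with its three sources and three `K`-faces (the face of `ℓ₁` at `p` has closure `K_p` and is shared by
the two sources `≠ p`).  The outside points VISIBLE on the side are those off at least one of its three closures; a visible
point in `H` is free (in no `K_p`) or attached to one `p`, a visible point off `H` likewise and it is GOOD for every source
of the side (Night2ShapeOneSigma, proofs/NIGHT-2-g30.md §3).  With the counts `fE` (free, in `H`), `a_p` (attached, in `H`),
`zf` (free, off `H`), `z_p` (attached, off `H`): `s_p = fE + zf + (a_c + z_c) + (a_d + z_d)` visible points off `K_p`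
(`m(K_p) = 2 + s_p`) and `g_p = 1 + fE + a_p + zf + (z₁ + z₂ + z₃)` good points of the source `p`.  The CORE lemmas take the
three losses `L_q` abstractly with their three properties (`lossHF_props`): nonnegative, `≤ sigHF s_c + sigHF s_d`, and
vanishing when a face of the source is null.  This part: **P1** (`sideHF_le_P1`, the load of a side is at most `92/360`, in the request form) and **B2** (`sideHF_core_zeta`: a visible `Z`-point gives `≤ 159/720`).
-/

namespace PercRepro.Shadow

section Side

variable {fE a₁ a₂ a₃ zf z₁ z₂ z₃ s₁ s₂ s₃ g₁ g₂ g₃ : ℕ} {r₁ r₂ r₃ : ℚ} {L₁ L₂ L₃ : ℚ}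

set_option maxHeartbeats 800000 in
/-- **P1.** In the H-fat regime (`r_H = 7/24`, no fat `K`-face) the load of a side is at most `92/360 = 23/90`: the three
losses, each bounded by the σ-decomposition, split over the good points (`proofs/NIGHT-2-g30.md` §3, P1). -/
theorem sideHF_le_P1
    (hs₁ : s₁ = fE + zf + (a₂ + z₂) + (a₃ + z₃)) (hs₂ : s₂ = fE + zf + (a₁ + z₁) + (a₃ + z₃))
    (hs₃ : s₃ = fE + zf + (a₁ + z₁) + (a₂ + z₂))
    (hg₁ : g₁ = 1 + fE + a₁ + zf + (z₁ + z₂ + z₃)) (hg₂ : g₂ = 1 + fE + a₂ + zf + (z₁ + z₂ + z₃))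
    (hg₃ : g₃ = 1 + fE + a₃ + zf + (z₁ + z₂ + z₃))
    (hr₁ : r₁ ≤ rhoReq (2 + s₁)) (h₁0 : s₁ = 0 → r₁ = 0) (hr₂ : r₂ ≤ rhoReq (2 + s₂)) (h₂0 : s₂ = 0 → r₂ = 0)
    (hr₃ : r₃ ≤ rhoReq (2 + s₃)) (h₃0 : s₃ = 0 → r₃ = 0) :
    max (7 / 24 + r₂ + r₃ - 11 / 18) 0 / (g₁ : ℚ) + max (7 / 24 + r₁ + r₃ - 11 / 18) 0 / (g₂ : ℚ) +
      max (7 / 24 + r₁ + r₂ - 11 / 18) 0 / (g₃ : ℚ) ≤ 23 / 90 := by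
  have hB₁ := lossHF_le_sigHF_add hr₂ h₂0 hr₃ h₃0
  have hB₂ := lossHF_le_sigHF_add hr₁ h₁0 hr₃ h₃0
  have hB₃ := lossHF_le_sigHF_add hr₁ h₁0 hr₂ h₂0
  have hL₁ : 0 ≤ max (7 / 24 + r₂ + r₃ - 11 / 18) 0 := le_max_right _ _
  have hL₂ : 0 ≤ max (7 / 24 + r₁ + r₃ - 11 / 18) 0 := le_max_right _ _
  have hL₃ : 0 ≤ max (7 / 24 + r₁ + r₂ - 11 / 18) 0 := le_max_right _ _
  have hσ₁ := sigHF_nonneg s₁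
  have hσ₂ := sigHF_nonneg s₂
  have hσ₃ := sigHF_nonneg s₃
  rcases Nat.lt_or_ge (fE + zf) 2 with hf | hf
  swap
  · -- `f ≥ 2`: every face has `s ≥ 2`, every source `g ≥ 3`
    have e₁ := sigHF_le_two (s := s₁) (by omega)
    have e₂ := sigHF_le_two (s := s₂) (by omega)
    have e₃ := sigHF_le_two (s := s₃) (by omega)
    have t₁ := div_nat_le_div_of_le hL₁ (hB₁.trans (by linarith : sigHF s₂ + sigHF s₃ ≤ 50 / 720)) (g := g₁) (k := 3) (by norm_num) (by omega)
    have t₂ := div_nat_le_div_of_le hL₂ (hB₂.trans (by linarith : sigHF s₁ + sigHF s₃ ≤ 50 / 720)) (g := g₂) (k := 3) (by norm_num) (by omega)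
    have t₃ := div_nat_le_div_of_le hL₃ (hB₃.trans (by linarith : sigHF s₁ + sigHF s₂ ≤ 50 / 720)) (g := g₃) (k := 3) (by norm_num) (by omega)
    norm_num at t₁ t₂ t₃
    linarith
  rcases Nat.lt_or_ge (fE + zf) 1 with hf0 | hf1
  swap
  · -- `f = 1`: every face has `s ≥ 1`, every source `g ≥ 2`
    have hf1' : fE + zf = 1 := by omega
    by_cases hn : a₁ + z₁ = 0 ∧ a₂ + z₂ = 0 ∧ a₃ + z₃ = 0
    · -- all `s = 1`: three losses `≤ 106/720` over `g ≥ 2`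
      obtain ⟨hn₁, hn₂, hn₃⟩ := hn
      have e₁ : sigHF s₁ = 53 / 720 := by rw [show s₁ = 1 by omega]; exact sigHF_one
      have e₂ : sigHF s₂ = 53 / 720 := by rw [show s₂ = 1 by omega]; exact sigHF_one
      have e₃ : sigHF s₃ = 53 / 720 := by rw [show s₃ = 1 by omega]; exact sigHF_one
      have t₁ := div_nat_le_div_of_le hL₁ (hB₁.trans (by rw [e₂, e₃]; norm_num : sigHF s₂ + sigHF s₃ ≤ 106 / 720)) (g := g₁) (k := 2) (by norm_num) (by omega)
      have t₂ := div_nat_le_div_of_le hL₂ (hB₂.trans (by rw [e₁, e₃]; norm_num : sigHF s₁ + sigHF s₃ ≤ 106 / 720)) (g := g₂) (k := 2) (by norm_num) (by omega)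
      have t₃ := div_nat_le_div_of_le hL₃ (hB₃.trans (by rw [e₁, e₂]; norm_num : sigHF s₁ + sigHF s₂ ≤ 106 / 720)) (g := g₃) (k := 2) (by norm_num) (by omega)
      norm_num at t₁ t₂ t₃
      linarith
    · -- some `n_p ≥ 1`: the two other faces have `s ≥ 2`, and `g_p ≥ 3`
      have hσ₁' := sigHF_le_one s₁
      have hσ₂' := sigHF_le_one s₂
      have hσ₃' := sigHF_le_one s₃
      have key : ∀ (tp tc td : ℚ), 0 ≤ tp → 0 ≤ tc → 0 ≤ td → tp ≤ 50 / 720 / 3 → tc ≤ 78 / 720 / 2 → td ≤ 78 / 720 / 2 →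
          tp + tc + td ≤ 23 / 90 := by intros; linarith
      rcases Nat.eq_zero_or_pos (a₁ + z₁) with h1 | h1
      · rcases Nat.eq_zero_or_pos (a₂ + z₂) with h2 | h2
        · have h3 : 0 < a₃ + z₃ := by omega
          -- `p = 3`
          have e₁ := sigHF_le_two (s := s₁) (by omega)
          have e₂ := sigHF_le_two (s := s₂) (by omega)
          have t₃ := div_nat_le_div_of_le hL₃ (hB₃.trans (by linarith : sigHF s₁ + sigHF s₂ ≤ 50 / 720)) (g := g₃) (k := 3) (by norm_num) (by omega)
          have t₁ := div_nat_le_div_of_le hL₁ (hB₁.trans (by linarith : sigHF s₂ + sigHF s₃ ≤ 78 / 720)) (g := g₁) (k := 2) (by norm_num) (by omega)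
          have t₂ := div_nat_le_div_of_le hL₂ (hB₂.trans (by linarith : sigHF s₁ + sigHF s₃ ≤ 78 / 720)) (g := g₂) (k := 2) (by norm_num) (by omega)
          exact key _ _ _ (by positivity) (by positivity) (by positivity) t₃ t₁ t₂ |> fun h => by linarith
        · -- `p = 2`
          have e₁ := sigHF_le_two (s := s₁) (by omega)
          have e₃ := sigHF_le_two (s := s₃) (by omega)
          have t₂ := div_nat_le_div_of_le hL₂ (hB₂.trans (by linarith : sigHF s₁ + sigHF s₃ ≤ 50 / 720)) (g := g₂) (k := 3) (by norm_num) (by omega)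
          have t₁ := div_nat_le_div_of_le hL₁ (hB₁.trans (by linarith : sigHF s₂ + sigHF s₃ ≤ 78 / 720)) (g := g₁) (k := 2) (by norm_num) (by omega)
          have t₃ := div_nat_le_div_of_le hL₃ (hB₃.trans (by linarith : sigHF s₁ + sigHF s₂ ≤ 78 / 720)) (g := g₃) (k := 2) (by norm_num) (by omega)
          exact key _ _ _ (by positivity) (by positivity) (by positivity) t₂ t₁ t₃ |> fun h => by linarith
      · -- `p = 1`
        have e₂ := sigHF_le_two (s := s₂) (by omega)
        have e₃ := sigHF_le_two (s := s₃) (by omega)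
        have t₁ := div_nat_le_div_of_le hL₁ (hB₁.trans (by linarith : sigHF s₂ + sigHF s₃ ≤ 50 / 720)) (g := g₁) (k := 3) (by norm_num) (by omega)
        have t₂ := div_nat_le_div_of_le hL₂ (hB₂.trans (by linarith : sigHF s₁ + sigHF s₃ ≤ 78 / 720)) (g := g₂) (k := 2) (by norm_num) (by omega)
        have t₃ := div_nat_le_div_of_le hL₃ (hB₃.trans (by linarith : sigHF s₁ + sigHF s₂ ≤ 78 / 720)) (g := g₃) (k := 2) (by norm_num) (by omega)
        exact key _ _ _ (by positivity) (by positivity) (by positivity) t₁ t₂ t₃ |> fun h => by linarith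
  · -- `f = 0`: `s_p = n_c + n_d`
    have hfE : fE = 0 := by omega
    have hzf : zf = 0 := by omega
    -- the two-null-face helper: the only loss is that of the source whose face is the common face
    have null2 : ∀ (tp tc td : ℚ) (n : ℕ) (gp : ℕ), tc = 0 → td = 0 → 0 ≤ tp → 1 + n ≤ gp →
        tp ≤ 2 * sigHF n / ((1 + n : ℕ) : ℚ) → tp + tc + td ≤ 23 / 90 := by
      intro tp tc td n gp htc htd _ _ htp
      have := two_sigHF_div_le n
      linarith
    -- the one-null-face helper
    have null1 : ∀ (tp tc td : ℚ) (nc nd : ℕ), 1 ≤ nc → 1 ≤ nd → tp ≤ sigHF nc + sigHF nd →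
        tc ≤ (25 / 720 + sigHF nc) / ((1 + nc : ℕ) : ℚ) → td ≤ (25 / 720 + sigHF nd) / ((1 + nd : ℕ) : ℚ) →
        tp + tc + td ≤ 23 / 90 := by
      intro tp tc td nc nd hc hd htp htc htd
      have := phiHF_le nc hc
      have := phiHF_le nd hd
      linarith
    rcases Nat.eq_zero_or_pos (a₁ + z₁) with h1 | h1
    · rcases Nat.eq_zero_or_pos (a₂ + z₂) with h2 | h2
      · -- `n₁ = n₂ = 0`: the face `3` is null
        have hs₃0 : s₃ = 0 := by omega
        have hr₃0 := h₃0 hs₃0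
        have u₁ := lossHF_eq_zero_of_null_right hr₃0 hr₂ h₂0
        have u₂ := lossHF_eq_zero_of_null_right hr₃0 hr₁ h₁0
        have hs₁ : s₁ = a₃ + z₃ := by omega
        have hs₂ : s₂ = a₃ + z₃ := by omega
        have t₃ := div_nat_le_div_of_le hL₃ (hB₃.trans (by rw [hs₁, hs₂]; linarith : sigHF s₁ + sigHF s₂ ≤ 2 * sigHF (a₃ + z₃)))
          (g := g₃) (k := 1 + (a₃ + z₃)) (by omega) (by omega)
        rw [u₁, u₂, zero_div_nat, zero_div_nat]
        exact null2 _ _ _ (a₃ + z₃) g₃ rfl rfl (by positivity) (by omega) t₃ |> fun h => by linarith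
      · rcases Nat.eq_zero_or_pos (a₃ + z₃) with h3 | h3
        · -- `n₁ = n₃ = 0`: the face `2` is null
          have hs₂0 : s₂ = 0 := by omega
          have hr₂0 := h₂0 hs₂0
          have u₁ := lossHF_eq_zero_of_null_left hr₂0 hr₃ h₃0
          have u₃ := lossHF_eq_zero_of_null_right hr₂0 hr₁ h₁0
          have hs₁ : s₁ = a₂ + z₂ := by omega
          have hs₃ : s₃ = a₂ + z₂ := by omega
          have t₂ := div_nat_le_div_of_le hL₂ (hB₂.trans (by rw [hs₁, hs₃]; linarith : sigHF s₁ + sigHF s₃ ≤ 2 * sigHF (a₂ + z₂)))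
            (g := g₂) (k := 1 + (a₂ + z₂)) (by omega) (by omega)
          rw [u₁, u₃, zero_div_nat, zero_div_nat]
          exact null2 _ _ _ (a₂ + z₂) g₂ rfl rfl (by positivity) (by omega) t₂ |> fun h => by linarith
        · -- `n₁ = 0 < n₂, n₃`: one null-type face? no — `s₁ = n₂ + n₃ ≥ 2`, `s₂ = n₃`, `s₃ = n₂`
          have hs₂ : s₂ = a₃ + z₃ := by omega
          have hs₃ : s₃ = a₂ + z₂ := by omega
          have e₁ := sigHF_le_two (s := s₁) (by omega)
          have t₁ := div_nat_le_div_of_le hL₁ hB₁ (g := g₁) (k := 1) (by norm_num) (by omega)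
          have t₂ := div_nat_le_div_of_le hL₂ (hB₂.trans (by linarith : sigHF s₁ + sigHF s₃ ≤ 25 / 720 + sigHF s₃))
            (g := g₂) (k := 1 + (a₂ + z₂)) (by omega) (by omega)
          have t₃ := div_nat_le_div_of_le hL₃ (hB₃.trans (by linarith : sigHF s₁ + sigHF s₂ ≤ 25 / 720 + sigHF s₂))
            (g := g₃) (k := 1 + (a₃ + z₃)) (by omega) (by omega)
          rw [hs₂, hs₃] at t₁
          rw [hs₃] at t₂
          rw [hs₂] at t₃
          norm_num at t₁
          exact null1 _ _ _ (a₂ + z₂) (a₃ + z₃) (by omega) (by omega) (by linarith) t₂ t₃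
    · rcases Nat.eq_zero_or_pos (a₂ + z₂) with h2 | h2
      · rcases Nat.eq_zero_or_pos (a₃ + z₃) with h3 | h3
        · -- `n₂ = n₃ = 0`: the face `1` is null
          have hs₁0 : s₁ = 0 := by omega
          have hr₁0 := h₁0 hs₁0
          have u₂ := lossHF_eq_zero_of_null_left hr₁0 hr₃ h₃0
          have u₃ := lossHF_eq_zero_of_null_left hr₁0 hr₂ h₂0
          have hs₂ : s₂ = a₁ + z₁ := by omega
          have hs₃ : s₃ = a₁ + z₁ := by omega
          have t₁ := div_nat_le_div_of_le hL₁ (hB₁.trans (by rw [hs₂, hs₃]; linarith : sigHF s₂ + sigHF s₃ ≤ 2 * sigHF (a₁ + z₁)))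
            (g := g₁) (k := 1 + (a₁ + z₁)) (by omega) (by omega)
          rw [u₂, u₃, zero_div_nat, zero_div_nat]
          exact null2 _ _ _ (a₁ + z₁) g₁ rfl rfl (by positivity) (by omega) t₁ |> fun h => by linarith
        · -- `n₂ = 0 < n₁, n₃`
          have hs₁ : s₁ = a₃ + z₃ := by omega
          have hs₃ : s₃ = a₁ + z₁ := by omega
          have e₂ := sigHF_le_two (s := s₂) (by omega)
          have t₂ := div_nat_le_div_of_le hL₂ hB₂ (g := g₂) (k := 1) (by norm_num) (by omega)
          have t₁ := div_nat_le_div_of_le hL₁ (hB₁.trans (by linarith : sigHF s₂ + sigHF s₃ ≤ 25 / 720 + sigHF s₃))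
            (g := g₁) (k := 1 + (a₁ + z₁)) (by omega) (by omega)
          have t₃ := div_nat_le_div_of_le hL₃ (hB₃.trans (by linarith : sigHF s₁ + sigHF s₂ ≤ 25 / 720 + sigHF s₁))
            (g := g₃) (k := 1 + (a₃ + z₃)) (by omega) (by omega)
          rw [hs₁, hs₃] at t₂
          rw [hs₃] at t₁
          rw [hs₁] at t₃
          norm_num at t₂
          have h := null1 (max (7 / 24 + r₁ + r₃ - 11 / 18) 0 / (g₂ : ℚ)) _ _ (a₁ + z₁) (a₃ + z₃) (by omega) (by omega)
            (by linarith) t₁ t₃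
          linarith
      · rcases Nat.eq_zero_or_pos (a₃ + z₃) with h3 | h3
        · -- `n₃ = 0 < n₁, n₂`
          have hs₁ : s₁ = a₂ + z₂ := by omega
          have hs₂ : s₂ = a₁ + z₁ := by omega
          have e₃ := sigHF_le_two (s := s₃) (by omega)
          have t₃ := div_nat_le_div_of_le hL₃ hB₃ (g := g₃) (k := 1) (by norm_num) (by omega)
          have t₁ := div_nat_le_div_of_le hL₁ (hB₁.trans (by linarith : sigHF s₂ + sigHF s₃ ≤ 25 / 720 + sigHF s₂))
            (g := g₁) (k := 1 + (a₁ + z₁)) (by omega) (by omega)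
          have t₂ := div_nat_le_div_of_le hL₂ (hB₂.trans (by linarith : sigHF s₁ + sigHF s₃ ≤ 25 / 720 + sigHF s₁))
            (g := g₂) (k := 1 + (a₂ + z₂)) (by omega) (by omega)
          rw [hs₁, hs₂] at t₃
          rw [hs₂] at t₁
          rw [hs₁] at t₂
          norm_num at t₃
          have h := null1 (max (7 / 24 + r₁ + r₂ - 11 / 18) 0 / (g₃ : ℚ)) _ _ (a₁ + z₁) (a₂ + z₂) (by omega) (by omega)
            (by linarith) t₁ t₂
          linarith
        · -- all `n ≥ 1`: every `s ≥ 2`, every `g ≥ 2`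
          have e₁ := sigHF_le_two (s := s₁) (by omega)
          have e₂ := sigHF_le_two (s := s₂) (by omega)
          have e₃ := sigHF_le_two (s := s₃) (by omega)
          have t₁ := div_nat_le_div_of_le hL₁ (hB₁.trans (by linarith : sigHF s₂ + sigHF s₃ ≤ 50 / 720)) (g := g₁) (k := 2) (by norm_num) (by omega)
          have t₂ := div_nat_le_div_of_le hL₂ (hB₂.trans (by linarith : sigHF s₁ + sigHF s₃ ≤ 50 / 720)) (g := g₂) (k := 2) (by norm_num) (by omega)
          have t₃ := div_nat_le_div_of_le hL₃ (hB₃.trans (by linarith : sigHF s₁ + sigHF s₂ ≤ 50 / 720)) (g := g₃) (k := 2) (by norm_num) (by omega)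
          norm_num at t₁ t₂ t₃
          linarith



set_option maxHeartbeats 1600000 in
/-- **B2 (core).** A visible `Z`-point (`ζ ≥ 1`, good for every source) bounds the side load by `159/720`. -/
theorem sideHF_core_zeta
    (hs₁ : s₁ = fE + zf + (a₂ + z₂) + (a₃ + z₃)) (hs₂ : s₂ = fE + zf + (a₁ + z₁) + (a₃ + z₃))
    (hs₃ : s₃ = fE + zf + (a₁ + z₁) + (a₂ + z₂))
    (hg₁ : g₁ = 1 + fE + a₁ + zf + (z₁ + z₂ + z₃)) (hg₂ : g₂ = 1 + fE + a₂ + zf + (z₁ + z₂ + z₃))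
    (hg₃ : g₃ = 1 + fE + a₃ + zf + (z₁ + z₂ + z₃))
    (hL₁ : 0 ≤ L₁) (hB₁ : L₁ ≤ sigHF s₂ + sigHF s₃) (hn₁ : s₂ = 0 ∨ s₃ = 0 → L₁ = 0)
    (hL₂ : 0 ≤ L₂) (hB₂ : L₂ ≤ sigHF s₁ + sigHF s₃) (hn₂ : s₁ = 0 ∨ s₃ = 0 → L₂ = 0)
    (hL₃ : 0 ≤ L₃) (hB₃ : L₃ ≤ sigHF s₁ + sigHF s₂) (hn₃ : s₁ = 0 ∨ s₂ = 0 → L₃ = 0)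
    (hζ : 1 ≤ zf + (z₁ + z₂ + z₃)) :
    L₁ / (g₁ : ℚ) + L₂ / (g₂ : ℚ) + L₃ / (g₃ : ℚ) ≤ 159 / 720 := by
  have hσ₁ := sigHF_nonneg s₁
  have hσ₂ := sigHF_nonneg s₂
  have hσ₃ := sigHF_nonneg s₃
  have hσ₁' := sigHF_le_one s₁
  have hσ₂' := sigHF_le_one s₂
  have hσ₃' := sigHF_le_one s₃
  -- every `g ≥ 2`
  have hg₁2 : 2 ≤ g₁ := by omega
  have hg₂2 : 2 ≤ g₂ := by omega
  have hg₃2 : 2 ≤ g₃ := by omega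
  rcases Nat.lt_or_ge (fE + zf) 2 with hf | hf
  swap
  · have e₁ := sigHF_le_two (s := s₁) (by omega)
    have e₂ := sigHF_le_two (s := s₂) (by omega)
    have e₃ := sigHF_le_two (s := s₃) (by omega)
    have t₁ := div_nat_le_div_of_le hL₁ (hB₁.trans (by linarith : sigHF s₂ + sigHF s₃ ≤ 50 / 720)) (g := g₁) (k := 3) (by norm_num) (by omega)
    have t₂ := div_nat_le_div_of_le hL₂ (hB₂.trans (by linarith : sigHF s₁ + sigHF s₃ ≤ 50 / 720)) (g := g₂) (k := 3) (by norm_num) (by omega)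
    have t₃ := div_nat_le_div_of_le hL₃ (hB₃.trans (by linarith : sigHF s₁ + sigHF s₂ ≤ 50 / 720)) (g := g₃) (k := 3) (by norm_num) (by omega)
    norm_num at t₁ t₂ t₃
    linarith
  rcases Nat.lt_or_ge (fE + zf) 1 with hf0 | hf1
  swap
  · -- `f = 1`, every `s ≥ 1`
    by_cases hn : a₁ + z₁ = 0 ∧ a₂ + z₂ = 0 ∧ a₃ + z₃ = 0
    · obtain ⟨hn₁', hn₂', hn₃'⟩ := hn
      have e₁ : sigHF s₁ = 53 / 720 := by rw [show s₁ = 1 by omega]; exact sigHF_one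
      have e₂ : sigHF s₂ = 53 / 720 := by rw [show s₂ = 1 by omega]; exact sigHF_one
      have e₃ : sigHF s₃ = 53 / 720 := by rw [show s₃ = 1 by omega]; exact sigHF_one
      have t₁ := div_nat_le_div_of_le hL₁ (hB₁.trans (by rw [e₂, e₃]; norm_num : sigHF s₂ + sigHF s₃ ≤ 106 / 720)) (g := g₁) (k := 2) (by norm_num) hg₁2
      have t₂ := div_nat_le_div_of_le hL₂ (hB₂.trans (by rw [e₁, e₃]; norm_num : sigHF s₁ + sigHF s₃ ≤ 106 / 720)) (g := g₂) (k := 2) (by norm_num) hg₂2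
      have t₃ := div_nat_le_div_of_le hL₃ (hB₃.trans (by rw [e₁, e₂]; norm_num : sigHF s₁ + sigHF s₂ ≤ 106 / 720)) (g := g₃) (k := 2) (by norm_num) hg₃2
      norm_num at t₁ t₂ t₃
      linarith
    · -- some `n_p ≥ 1`: its two neighbours have `s ≥ 2`; all terms `≤ 78/1440`, one `≤ 50/2160`
      have key : ∀ (tp tc td : ℚ), tp ≤ 50 / 720 / 3 → tc ≤ 78 / 720 / 2 → td ≤ 78 / 720 / 2 → tp + tc + td ≤ 159 / 720 := by
        intros; linarith
      rcases Nat.eq_zero_or_pos (a₁ + z₁) with h1 | h1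
      · rcases Nat.eq_zero_or_pos (a₂ + z₂) with h2 | h2
        · have e₁ := sigHF_le_two (s := s₁) (by omega)
          have e₂ := sigHF_le_two (s := s₂) (by omega)
          have t₃ := div_nat_le_div_of_le hL₃ (hB₃.trans (by linarith : sigHF s₁ + sigHF s₂ ≤ 50 / 720)) (g := g₃) (k := 3) (by norm_num) (by omega)
          have t₁ := div_nat_le_div_of_le hL₁ (hB₁.trans (by linarith : sigHF s₂ + sigHF s₃ ≤ 78 / 720)) (g := g₁) (k := 2) (by norm_num) hg₁2
          have t₂ := div_nat_le_div_of_le hL₂ (hB₂.trans (by linarith : sigHF s₁ + sigHF s₃ ≤ 78 / 720)) (g := g₂) (k := 2) (by norm_num) hg₂2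
          have := key _ _ _ t₃ t₁ t₂; linarith
        · have e₁ := sigHF_le_two (s := s₁) (by omega)
          have e₃ := sigHF_le_two (s := s₃) (by omega)
          have t₂ := div_nat_le_div_of_le hL₂ (hB₂.trans (by linarith : sigHF s₁ + sigHF s₃ ≤ 50 / 720)) (g := g₂) (k := 3) (by norm_num) (by omega)
          have t₁ := div_nat_le_div_of_le hL₁ (hB₁.trans (by linarith : sigHF s₂ + sigHF s₃ ≤ 78 / 720)) (g := g₁) (k := 2) (by norm_num) hg₁2
          have t₃ := div_nat_le_div_of_le hL₃ (hB₃.trans (by linarith : sigHF s₁ + sigHF s₂ ≤ 78 / 720)) (g := g₃) (k := 2) (by norm_num) hg₃2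
          have := key _ _ _ t₂ t₁ t₃; linarith
      · have e₂ := sigHF_le_two (s := s₂) (by omega)
        have e₃ := sigHF_le_two (s := s₃) (by omega)
        have t₁ := div_nat_le_div_of_le hL₁ (hB₁.trans (by linarith : sigHF s₂ + sigHF s₃ ≤ 50 / 720)) (g := g₁) (k := 3) (by norm_num) (by omega)
        have t₂ := div_nat_le_div_of_le hL₂ (hB₂.trans (by linarith : sigHF s₁ + sigHF s₃ ≤ 78 / 720)) (g := g₂) (k := 2) (by norm_num) hg₂2
        have t₃ := div_nat_le_div_of_le hL₃ (hB₃.trans (by linarith : sigHF s₁ + sigHF s₂ ≤ 78 / 720)) (g := g₃) (k := 2) (by norm_num) hg₃2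
        have := key _ _ _ t₁ t₂ t₃; linarith
  · -- `f = 0`
    have hfE : fE = 0 := by omega
    have hzf : zf = 0 := by omega
    -- crude: every term is at most `106/720/2 = 53/720` and a null face kills two terms; otherwise with at most one
    -- `n_p = 0` the neighbours' σ-sums are `≤ 78/720`
    have t₁' := div_nat_le_div_of_le hL₁ hB₁ (g := g₁) (k := 2) (by norm_num) hg₁2
    have t₂' := div_nat_le_div_of_le hL₂ hB₂ (g := g₂) (k := 2) (by norm_num) hg₂2
    have t₃' := div_nat_le_div_of_le hL₃ hB₃ (g := g₃) (k := 2) (by norm_num) hg₃2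
    by_cases hnull : s₁ = 0 ∨ s₂ = 0 ∨ s₃ = 0
    · rcases hnull with h | h | h
      · rw [hn₂ (Or.inl h), hn₃ (Or.inl h), zero_div_nat, zero_div_nat]
        linarith
      · rw [hn₁ (Or.inl h), hn₃ (Or.inr h), zero_div_nat, zero_div_nat]
        linarith
      · rw [hn₁ (Or.inr h), hn₂ (Or.inr h), zero_div_nat, zero_div_nat]
        linarith
    · push Not at hnull
      -- at most one `n_p = 0`; the two faces adjacent to a nonzero `n_p` have `s ≥ 2`... we use: every `s ≥ 1`, and for
      -- each source at most one of its two faces has `s = 1` unless the configuration is `(0;1,1,0)`-like; crude 53 + 39 + 39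
      have key : ∀ (tp tc td : ℚ), tp ≤ 106 / 720 / 2 → tc ≤ 78 / 720 / 2 → td ≤ 78 / 720 / 2 → tp + tc + td ≤ 159 / 720 := by
        intros; linarith
      rcases Nat.eq_zero_or_pos (a₁ + z₁) with h1 | h1
      · -- `n₁ = 0`, `n₂, n₃ ≥ 1` (else a null face): `s₁ = n₂ + n₃ ≥ 2`
        have e₁ := sigHF_le_two (s := s₁) (by omega)
        have t₂ := div_nat_le_div_of_le hL₂ (hB₂.trans (by linarith : sigHF s₁ + sigHF s₃ ≤ 78 / 720)) (g := g₂) (k := 2) (by norm_num) hg₂2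
        have t₃ := div_nat_le_div_of_le hL₃ (hB₃.trans (by linarith : sigHF s₁ + sigHF s₂ ≤ 78 / 720)) (g := g₃) (k := 2) (by norm_num) hg₃2
        have := key _ _ _ (t₁'.trans (by linarith)) t₂ t₃; linarith
      · rcases Nat.eq_zero_or_pos (a₂ + z₂) with h2 | h2
        · have e₂ := sigHF_le_two (s := s₂) (by omega)
          have t₁ := div_nat_le_div_of_le hL₁ (hB₁.trans (by linarith : sigHF s₂ + sigHF s₃ ≤ 78 / 720)) (g := g₁) (k := 2) (by norm_num) hg₁2
          have t₃ := div_nat_le_div_of_le hL₃ (hB₃.trans (by linarith : sigHF s₁ + sigHF s₂ ≤ 78 / 720)) (g := g₃) (k := 2) (by norm_num) hg₃2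
          have := key _ _ _ (t₂'.trans (by linarith)) t₁ t₃; linarith
        · rcases Nat.eq_zero_or_pos (a₃ + z₃) with h3 | h3
          · have e₃ := sigHF_le_two (s := s₃) (by omega)
            have t₁ := div_nat_le_div_of_le hL₁ (hB₁.trans (by linarith : sigHF s₂ + sigHF s₃ ≤ 78 / 720)) (g := g₁) (k := 2) (by norm_num) hg₁2
            have t₂ := div_nat_le_div_of_le hL₂ (hB₂.trans (by linarith : sigHF s₁ + sigHF s₃ ≤ 78 / 720)) (g := g₂) (k := 2) (by norm_num) hg₂2
            have := key _ _ _ (t₃'.trans (by linarith)) t₁ t₂; linarith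
          · -- all `n ≥ 1`: all `s ≥ 2`
            have e₁ := sigHF_le_two (s := s₁) (by omega)
            have e₂ := sigHF_le_two (s := s₂) (by omega)
            have e₃ := sigHF_le_two (s := s₃) (by omega)
            have t₁ := div_nat_le_div_of_le hL₁ (hB₁.trans (by linarith : sigHF s₂ + sigHF s₃ ≤ 50 / 720)) (g := g₁) (k := 2) (by norm_num) hg₁2
            have t₂ := div_nat_le_div_of_le hL₂ (hB₂.trans (by linarith : sigHF s₁ + sigHF s₃ ≤ 50 / 720)) (g := g₂) (k := 2) (by norm_num) hg₂2
            have t₃ := div_nat_le_div_of_le hL₃ (hB₃.trans (by linarith : sigHF s₁ + sigHF s₂ ≤ 50 / 720)) (g := g₃) (k := 2) (by norm_num) hg₃2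
            norm_num at t₁ t₂ t₃
            linarith

end Side

end PercRepro.Shadow
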